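import Literature.Barriers.AtomisticToContinuum.NoBVEstimatesMultiDRegField
import Literature.Analysis.ODE.AprioriTwoSided
import Literature.Analysis.PDE.WordEnergySupBound
import Mathlib.MeasureTheory.Integral.IntervalIntegral.FundThmCalculus
import HarnessLib

/-!
# The regularised quasilinear flow on the whole time axis and its derived `L²` curves

Brick B-δ, §1–§2, of the Kato existence programme for the symmetrizable branch of Rauch's Local
Existence Theorem (towards `Rauch1986_smallAmplitudeExpansionL2`). For the Friedrichs
regularisation `U' = F_δ(U) = -J_δ G(J_δU)`, `G(w) = Σⱼ aⱼ(w)∂ⱼw + b(w)`, of the cut-off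
quasilinear system on `X = L²(ℝᵈ; ℝᵏ)` (`NoBVEstimatesMultiDRegField.lean`) this file provides
the objects on which the uniform-in-`δ` `Hᵐ` energy estimate [Majda1984, Ch. 2, Thm 2.1 (proof,
Step 1)], [TaylorPDEIII2011, Ch. 16, §1, (1.8)–(1.13)] is run:

* `exists_regularised_flow_real` — the regularised equation has a **global solution on all of
  `ℝ`** (`HasDerivAt` at every time; the tree's two-sided continuation principle with Grönwall's
  bound, which is insensitive to the direction of time);
* `derivedField α` — the fields `F_δ^{(α)}(V) = -(∂_αρ_δ) ⋆ G(ρ_δ ⋆ V)` on `X` (the word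
  derivative `∂_α` put on the mollifier), continuous on `X`; `derivedField [] = regField`;
* `dcurve α` — the **derived curves** `Y_α(t) = ∂_αu₀ + ∫₀ᵗ F_δ^{(α)}(U(s)) ds`, with
  `Y_α' = F_δ^{(α)}(U)` (`hasDerivAt_dcurve`) and `Y_{[]} = U` (`dcurve_nil`);
* `smoothRep_dcurve` — the **key identity** `ρ_δ ⋆ Y_α(t) = ∂_α(ρ_δ ⋆ U(t))`: the derived curves
  ARE the word derivatives of the flow, seen through the mollifier (both sides have the same time
  derivative `-(∂_α(ρ_δ ⋆ ρ_δ ⋆ G))(x)` at every point — derivatives pass onto the kernel or onto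
  a smooth field — and agree at `t = 0`; no associativity of convolution is used);
* consequences for `W(t) = ρ_δ ⋆ U(t)`: `‖∂_c W(t)‖₂ ≤ ‖Y_c(t)‖` (`l2norm_cwd_smoothRep_flow_le`),
  `‖∂ⱼ∂_c W(t)‖₂ ≤ (C₁(j)/δ)‖Y_c(t)‖` (`l2norm_cwd_cons_smoothRep_flow_le`), and the **Sobolev sup
  bound in the currency of the derived curves**
  `‖∂_c W(t)(x)‖² ≤ C_sob Σ_{|u| ≤ 2(d+1)} ‖Y_{uc}(t)‖²` (`norm_cwd_smoothRep_flow_sq_le`), the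
  right-hand side being dominated by the order-`m` energy `Σ_{|α| ≤ m} ‖Y_α(t)‖²` as soon as
  `|c| + 2(d + 1) ≤ m` (`sum_append_le_sum_wordsLE`, `norm_cwd_smoothRep_flow_sq_le_energy`).

Everything is proved; no named fact and no `sorry` is introduced.

## References

* [Majda1984] A. Majda, *Compressible Fluid Flow and Systems of Conservation Laws in Several
  Space Variables* (1984), Ch. 2, §2.1, Thm 2.1.
* [TaylorPDEIII2011] M. E. Taylor, *Partial Differential Equations III*, 2nd ed. (2011), Ch. 16,
  §1, (1.8)–(1.15).
* [Friedrichs1954] K. O. Friedrichs, Comm. Pure Appl. Math. 7 (1954) 345–392, §3.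
-/

noncomputable section

open MeasureTheory Set Function Filter Metric ContinuousLinearMap
open scoped ContDiff Topology ENNReal NNReal Convolution

namespace Literature.Barriers.AtomisticToContinuum

open Literature.Analysis.PDE Literature.Analysis.FunctionSpaces Literature.Analysis.ODE

variable {d k : ℕ}

/-- Shorthand: the state Hilbert space `W = ℝᵏ`. -/
local notation "W" k => EuclideanSpace ℝ (Fin k)
/-- Shorthand: physical space `ℝᵈ`. -/
local notation "E" d => EuclideanSpace ℝ (Fin d)

/-! ### The flow on the whole time axis -/

section Flow

variable {M L : ℝ} {a : Fin d → (W k) → ((W k) →L[ℝ] (W k))} {b : (W k) → (W k)}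

/-- **Global two-sided flow of the regularised quasilinear equation.** For every `δ > 0` and
`U₀ ∈ L²(ℝᵈ; ℝᵏ)` there is `U : ℝ → L²` with `U(0) = U₀` and `U'(t) = F_δ(U(t))` at every
`t ∈ ℝ` (Grönwall's bound `‖U(t)‖ ≤ ‖U₀‖e^{Λ_δ|t|}` from the linear growth of `F_δ` holds in both
time directions; `exists_solution_real_of_apriori_bound`). [cite: Majda1984, Ch. 2 §2.1];
[cite: TaylorPDEIII2011, Ch. 16 §1] -/
theorem exists_regularised_flow_real (h : IsTameCoeff M L a b) {δ : ℝ} (hδ : 0 < δ)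
    (U₀ : Lp (W k) 2 (volume : Measure (E d))) :
    ∃ U : ℝ → Lp (W k) 2 (volume : Measure (E d)), U 0 = U₀ ∧
      ∀ t, HasDerivAt U (regField h hδ (U t)) t := by
  set K : ℝ := growth M L d δ with hK
  have hK0 : 0 ≤ K := add_nonneg (mul_nonneg h.M_nonneg (derivCost_nonneg d hδ)) h.L_nonneg
  refine exists_solution_real_of_apriori_bound (f := regField h hδ) (x₀ := U₀)
    (fun R => ⟨_, lipschitzOnWith_regField h hδ R⟩) ?_
  intro c hc T hT
  refine ⟨‖U₀‖ * Real.exp (K * T), ?_, fun s hs α hα0 hα t ht => ?_⟩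
  · have : (1 : ℝ) ≤ Real.exp (K * T) := Real.one_le_exp (by positivity)
    nlinarith [norm_nonneg U₀]
  have hcontα : ContinuousOn α (Icc 0 s) := fun τ hτ => (hα τ hτ).continuousWithinAt
  have hder : ∀ τ ∈ Ico 0 s, HasDerivWithinAt α (c • regField h hδ (α τ)) (Ici τ) τ :=
    fun τ hτ => (hα τ (Ico_subset_Icc_self hτ)).mono_of_mem_nhdsWithin
      (mem_of_superset (Icc_mem_nhdsGE hτ.2) (Icc_subset_Icc hτ.1 le_rfl))
  have hbound : ∀ τ ∈ Ico 0 s, ‖c • regField h hδ (α τ)‖ ≤ K * ‖α τ‖ + 0 := fun τ _ => by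
    rw [add_zero, norm_smul, Real.norm_eq_abs, hc, one_mul]
    exact norm_regField_le h hδ (α τ)
  have hg := norm_le_gronwallBound_of_norm_deriv_right_le hcontα hder (le_of_eq (by rw [hα0]))
    hbound t ht
  rw [gronwallBound_ε0, sub_zero] at hg
  refine hg.trans ?_
  gcongr
  exact ht.2.trans hs.2

end Flow

/-! ### The derived fields `F_δ^{(α)}(V) = -(∂_αρ_δ) ⋆ G(ρ_δ ⋆ V)` -/

section Derived

variable {M L : ℝ} {a : Fin d → (W k) → ((W k) →L[ℝ] (W k))} {b : (W k) → (W k)}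

/-- The word derivatives of the mollifier are continuous. [folklore] -/
theorem continuous_cwd_moll {δ : ℝ} (hδ : 0 < δ) (α : List (Fin d)) :
    Continuous (cwd α (moll (Fin d) hδ)) :=
  (contDiff_cwd (contDiff_moll hδ) α).continuous

/-- The word derivatives of the mollifier have compact support. [folklore] -/
theorem hasCompactSupport_cwd_moll {δ : ℝ} (hδ : 0 < δ) (α : List (Fin d)) :
    HasCompactSupport (cwd α (moll (Fin d) hδ)) :=
  hasCompactSupport_cwd (hasCompactSupport_moll hδ) α

/-- **The derived field** `F_δ^{(α)}(V) = -(∂_αρ_δ) ⋆ G(ρ_δ ⋆ V)` on `L²` — the word derivative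
`∂_α` of `F_δ(V) = -ρ_δ ⋆ G(ρ_δ ⋆ V)` carried by the kernel. [cite: TaylorPDEIII2011, Ch. 16 §1, (1.8)] -/
def derivedField (h : IsTameCoeff M L a b) {δ : ℝ} (hδ : 0 < δ) (α : List (Fin d))
    (V : Lp (W k) 2 (volume : Measure (E d))) : Lp (W k) 2 (volume : Measure (E d)) :=
  -(convL2 (cwd α (moll (Fin d) hδ)) (continuous_cwd_moll hδ α) (hasCompactSupport_cwd_moll hδ α)
      ((memLp_gfield_smoothRep h hδ V).1.toLp _))

/-- The derived field of the empty word is the regularised field itself. [folklore] -/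
theorem derivedField_nil (h : IsTameCoeff M L a b) {δ : ℝ} (hδ : 0 < δ)
    (V : Lp (W k) 2 (volume : Measure (E d))) : derivedField h hδ [] V = regField h hδ V := rfl

/-- **Local Lipschitz bound for the derived field**:
`‖F^{(α)}(V) - F^{(α)}(V')‖ ≤ ‖∂_αρ_δ‖₁ (Λ_δ + M ‖ρ_δ‖₂ (Σⱼ C₁(j)/δ) ‖V'‖) ‖V - V'‖`.
[cite: Majda1984, Ch. 2 §2.1] -/
theorem norm_derivedField_sub_le (h : IsTameCoeff M L a b) {δ : ℝ} (hδ : 0 < δ) (α : List (Fin d))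
    (V V' : Lp (W k) 2 (volume : Measure (E d))) :
    ‖derivedField h hδ α V - derivedField h hδ α V'‖ ≤
      (∫ y, |cwd α (moll (Fin d) hδ) y|) *
        ((growth M L d δ + M * l2norm (moll (Fin d) hδ) * derivCost d δ * ‖V'‖) * ‖V - V'‖) := by
  obtain ⟨hm, hle⟩ := l2norm_gfield_smoothRep_sub_le h hδ V V'
  rw [norm_sub_rev, derivedField, derivedField, neg_sub_neg, ← map_sub,
    ← MemLp.toLp_sub (memLp_gfield_smoothRep h hδ V).1 (memLp_gfield_smoothRep h hδ V').1]
  refine (norm_convL2_le _ _ _).trans ?_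
  refine mul_le_mul_of_nonneg_left ?_ (integral_nonneg fun _ => abs_nonneg _)
  rw [Lp.norm_toLp, ← l2norm_def]
  exact hle

/-- The derived field is continuous on `L²`. [folklore] -/
theorem continuous_derivedField (h : IsTameCoeff M L a b) {δ : ℝ} (hδ : 0 < δ)
    (α : List (Fin d)) : Continuous (derivedField h hδ α) := by
  refine continuous_iff_continuousAt.2 fun V₀ => ?_
  rw [ContinuousAt, tendsto_iff_norm_sub_tendsto_zero]
  set C : ℝ := (∫ y, |cwd α (moll (Fin d) hδ) y|) *
    (growth M L d δ + M * l2norm (moll (Fin d) hδ) * derivCost d δ * ‖V₀‖) with hC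
  have hb : ∀ V, ‖derivedField h hδ α V - derivedField h hδ α V₀‖ ≤ C * ‖V - V₀‖ := fun V => by
    have := norm_derivedField_sub_le h hδ α V V₀
    rw [hC, mul_assoc]
    exact this
  refine squeeze_zero (fun V => norm_nonneg _) hb ?_
  have hcont : Continuous fun V : Lp (W k) 2 (volume : Measure (E d)) => C * ‖V - V₀‖ :=
    continuous_const.mul (continuous_norm.comp (continuous_id.sub continuous_const))
  simpa using hcont.tendsto V₀

/-- The mollification of a derived field, pointwise:
`(ρ_δ ⋆ F^{(α)}(V))(x) = -(∂_α(ρ_δ ⋆ (ρ_δ ⋆ G(ρ_δ ⋆ V))))(x)`. [folklore] -/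
theorem evalL2_moll_derivedField (h : IsTameCoeff M L a b) {δ : ℝ} (hδ : 0 < δ)
    (α : List (Fin d)) (V : Lp (W k) 2 (volume : Measure (E d))) (x : E d) :
    evalL2 (moll (Fin d) hδ) (continuous_moll hδ) (hasCompactSupport_moll hδ) x
        (derivedField h hδ α V) =
      -cwd α (moll (Fin d) hδ ⋆[lsmul ℝ ℝ, volume]
        (moll (Fin d) hδ ⋆[lsmul ℝ ℝ, volume] gfield a b (smoothRep (moll (Fin d) hδ) V))) x := by
  set ρ := moll (Fin d) hδ with hρ
  set G := gfield a b (smoothRep ρ V) with hG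
  have hGm : MemLp G 2 (volume : Measure (E d)) := (memLp_gfield_smoothRep h hδ V).1
  have hGl : LocallyIntegrable G (volume : Measure (E d)) := hGm.locallyIntegrable one_le_two
  have hρG : ContDiff ℝ ∞ (ρ ⋆[lsmul ℝ ℝ, volume] G) :=
    contDiff_convolution_kernel (contDiff_moll hδ) (hasCompactSupport_moll hδ) hGl
  rw [derivedField, map_neg, evalL2_apply]
  congr 1
  change (ρ ⋆[lsmul ℝ ℝ, volume] ((convL2 (cwd α ρ) (continuous_cwd_moll hδ α)
      (hasCompactSupport_cwd_moll hδ α) (hGm.toLp G) : Lp (W k) 2 volume) : (E d) → (W k))) x =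
    cwd α (ρ ⋆[lsmul ℝ ℝ, volume] (ρ ⋆[lsmul ℝ ℝ, volume] G)) x
  rw [convolution_coeFn_convL2, convolution_kernel_congr_ae (ρ := cwd α ρ) (MemLp.coeFn_toLp hGm),
    ← cwd_convolution_eq_convolution_cwd_kernel (contDiff_moll hδ) (hasCompactSupport_moll hδ) hGl,
    ← cwd_convolution_eq_convolution_cwd (continuous_moll hδ) (hasCompactSupport_moll hδ) hρG]

/-- The derived mollification of the regularised field, pointwise:
`((∂_αρ_δ) ⋆ F_δ(V))(x) = -(∂_α(ρ_δ ⋆ (ρ_δ ⋆ G(ρ_δ ⋆ V))))(x)`. [folklore] -/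
theorem evalL2_cwd_moll_regField (h : IsTameCoeff M L a b) {δ : ℝ} (hδ : 0 < δ)
    (α : List (Fin d)) (V : Lp (W k) 2 (volume : Measure (E d))) (x : E d) :
    evalL2 (cwd α (moll (Fin d) hδ)) (continuous_cwd_moll hδ α) (hasCompactSupport_cwd_moll hδ α) x
        (regField h hδ V) =
      -cwd α (moll (Fin d) hδ ⋆[lsmul ℝ ℝ, volume]
        (moll (Fin d) hδ ⋆[lsmul ℝ ℝ, volume] gfield a b (smoothRep (moll (Fin d) hδ) V))) x := by
  set ρ := moll (Fin d) hδ with hρ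
  set G := gfield a b (smoothRep ρ V) with hG
  have hGm : MemLp G 2 (volume : Measure (E d)) := (memLp_gfield_smoothRep h hδ V).1
  have hGl : LocallyIntegrable G (volume : Measure (E d)) := hGm.locallyIntegrable one_le_two
  have hρG : ContDiff ℝ ∞ (ρ ⋆[lsmul ℝ ℝ, volume] G) :=
    contDiff_convolution_kernel (contDiff_moll hδ) (hasCompactSupport_moll hδ) hGl
  have hρGl : LocallyIntegrable (ρ ⋆[lsmul ℝ ℝ, volume] G) (volume : Measure (E d)) :=
    hρG.continuous.locallyIntegrable
  rw [regField, map_neg, evalL2_apply]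
  congr 1
  change (cwd α ρ ⋆[lsmul ℝ ℝ, volume] ((mollL2 hδ (hGm.toLp G) : Lp (W k) 2 volume) :
      (E d) → (W k))) x = cwd α (ρ ⋆[lsmul ℝ ℝ, volume] (ρ ⋆[lsmul ℝ ℝ, volume] G)) x
  rw [mollL2, convolution_coeFn_convL2, convolution_kernel_congr_ae (ρ := ρ) (MemLp.coeFn_toLp hGm),
    ← cwd_convolution_eq_convolution_cwd_kernel (contDiff_moll hδ) (hasCompactSupport_moll hδ) hρGl]

end Derived

/-! ### The derived curves `Y_α(t) = ∂_αu₀ + ∫₀ᵗ F_δ^{(α)}(U(s)) ds` -/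

section Curves

variable {M L : ℝ} {a : Fin d → (W k) → ((W k) →L[ℝ] (W k))} {b : (W k) → (W k)}
variable {u₀ : (E d) → (W k)}

/-- Smooth compactly supported data have all word derivatives in `L²`. [folklore] -/
theorem memLp_cwd_data (hu₀ : ContDiff ℝ ∞ u₀) (hu₀c : HasCompactSupport u₀) (α : List (Fin d)) :
    MemLp (cwd α u₀) 2 (volume : Measure (E d)) :=
  (contDiff_cwd hu₀ α).continuous.memLp_of_hasCompactSupport (hasCompactSupport_cwd hu₀c α)

/-- The initial datum as an element of `L²`. [folklore] -/
def dataL2 (hu₀ : ContDiff ℝ ∞ u₀) (hu₀c : HasCompactSupport u₀) :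
    Lp (W k) 2 (volume : Measure (E d)) :=
  (memLp_cwd_data hu₀ hu₀c []).toLp _

/-- **The derived curves** `Y_α(t) = ∂_αu₀ + ∫₀ᵗ F_δ^{(α)}(U(s)) ds` of a curve `U : ℝ → L²`.
[cite: TaylorPDEIII2011, Ch. 16 §1, (1.8)] -/
def dcurve (h : IsTameCoeff M L a b) {δ : ℝ} (hδ : 0 < δ) (hu₀ : ContDiff ℝ ∞ u₀)
    (hu₀c : HasCompactSupport u₀) (U : ℝ → Lp (W k) 2 (volume : Measure (E d)))
    (α : List (Fin d)) (t : ℝ) : Lp (W k) 2 (volume : Measure (E d)) :=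
  (memLp_cwd_data hu₀ hu₀c α).toLp _ + ∫ s in (0 : ℝ)..t, derivedField h hδ α (U s)

variable (h : IsTameCoeff M L a b) {δ : ℝ} (hδ : 0 < δ) (hu₀ : ContDiff ℝ ∞ u₀)
  (hu₀c : HasCompactSupport u₀) {U : ℝ → Lp (W k) 2 (volume : Measure (E d))}

/-- At `t = 0` the derived curve is the word derivative of the datum. [folklore] -/
theorem dcurve_zero (α : List (Fin d)) :
    dcurve h hδ hu₀ hu₀c U α 0 = (memLp_cwd_data hu₀ hu₀c α).toLp _ := by
  simp [dcurve]

/-- **`Y_α' = F_δ^{(α)}(U)`** along a continuous curve `U`. [cite: TaylorPDEIII2011, Ch. 16 §1, (1.8)] -/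
theorem hasDerivAt_dcurve (hUc : Continuous U) (α : List (Fin d)) (t : ℝ) :
    HasDerivAt (dcurve h hδ hu₀ hu₀c U α) (derivedField h hδ α (U t)) t := by
  have hc : Continuous fun s => derivedField h hδ α (U s) :=
    (continuous_derivedField h hδ α).comp hUc
  have hI := intervalIntegral.integral_hasDerivAt_right (hc.intervalIntegrable 0 t)
    (hc.stronglyMeasurableAtFilter volume (𝓝 t)) hc.continuousAt
  have h2 := hI.const_add ((memLp_cwd_data hu₀ hu₀c α).toLp _)
  unfold dcurve
  exact h2

/-- The derived curves are continuous. [folklore] -/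
theorem continuous_dcurve (hUc : Continuous U) (α : List (Fin d)) :
    Continuous (dcurve h hδ hu₀ hu₀c U α) :=
  continuous_iff_continuousAt.2 fun t => (hasDerivAt_dcurve h hδ hu₀ hu₀c hUc α t).continuousAt

/-- **`Y_{[]} = U`** for a solution of the regularised equation issued from `u₀` (fundamental
theorem of calculus). [folklore] -/
theorem dcurve_nil (hU0 : U 0 = dataL2 hu₀ hu₀c)
    (hU : ∀ t, HasDerivAt U (regField h hδ (U t)) t) (t : ℝ) :
    dcurve h hδ hu₀ hu₀c U [] t = U t := by
  have hUc : Continuous U := continuous_iff_continuousAt.2 fun s => (hU s).continuousAt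
  have hc : Continuous fun s => regField h hδ (U s) := by
    have := (continuous_derivedField h hδ []).comp hUc
    simpa [Function.comp_def, derivedField_nil] using this
  have hftc := intervalIntegral.integral_eq_sub_of_hasDerivAt (fun s _ => hU s)
    (hc.intervalIntegrable 0 t)
  rw [dcurve]
  simp_rw [derivedField_nil]
  rw [hftc, hU0, dataL2]
  abel

/-! ### The key identity `ρ_δ ⋆ Y_α(t) = ∂_α(ρ_δ ⋆ U(t))` -/

/-- **The derived curves are the word derivatives of the flow, seen through the mollifier**:
`ρ_δ ⋆ Y_α(t) = ∂_α(ρ_δ ⋆ U(t))` for every word `α` and every `t ∈ ℝ`, for a solution `U` of the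
regularised equation with `U(0) = u₀`. Both sides, evaluated at a point, are differentiable in `t`
with the same derivative `-(∂_α(ρ_δ ⋆ ρ_δ ⋆ G(ρ_δ ⋆ U(t))))(x)` and agree at `t = 0`.
[cite: TaylorPDEIII2011, Ch. 16 §1, (1.8)–(1.10)] -/
theorem smoothRep_dcurve (hU0 : U 0 = dataL2 hu₀ hu₀c)
    (hU : ∀ t, HasDerivAt U (regField h hδ (U t)) t) (α : List (Fin d)) (t : ℝ) :
    smoothRep (moll (Fin d) hδ) (dcurve h hδ hu₀ hu₀c U α t) =
      cwd α (smoothRep (moll (Fin d) hδ) (U t)) := by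
  have hUc : Continuous U := continuous_iff_continuousAt.2 fun s => (hU s).continuousAt
  set ρ := moll (Fin d) hδ with hρ
  funext x
  -- the two sides as functions of time, through the evaluation functionals
  set Lf : ℝ → (W k) := fun s =>
    evalL2 ρ (continuous_moll hδ) (hasCompactSupport_moll hδ) x (dcurve h hδ hu₀ hu₀c U α s) with hLf
  set Rf : ℝ → (W k) := fun s =>
    evalL2 (cwd α ρ) (continuous_cwd_moll hδ α) (hasCompactSupport_cwd_moll hδ α) x (U s) with hRf
  -- the common derivative
  set φ : ℝ → (W k) := fun s =>
    -cwd α (ρ ⋆[lsmul ℝ ℝ, volume] (ρ ⋆[lsmul ℝ ℝ, volume] gfield a b (smoothRep ρ (U s)))) x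
    with hφ
  have hL : ∀ s, HasDerivAt Lf (φ s) s := fun s => by
    have h1 := ((evalL2 ρ (continuous_moll hδ) (hasCompactSupport_moll hδ) x :
      Lp (W k) 2 (volume : Measure (E d)) →L[ℝ] (W k)).hasFDerivAt).comp_hasDerivAt s
      (hasDerivAt_dcurve h hδ hu₀ hu₀c hUc α s)
    have h2 : (evalL2 ρ (continuous_moll hδ) (hasCompactSupport_moll hδ) x)
        (derivedField h hδ α (U s)) = φ s := evalL2_moll_derivedField h hδ α (U s) x
    rw [h2] at h1
    exact h1
  have hR : ∀ s, HasDerivAt Rf (φ s) s := fun s => by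
    have h1 := ((evalL2 (cwd α ρ) (continuous_cwd_moll hδ α) (hasCompactSupport_cwd_moll hδ α) x :
      Lp (W k) 2 (volume : Measure (E d)) →L[ℝ] (W k)).hasFDerivAt).comp_hasDerivAt s (hU s)
    have h2 : (evalL2 (cwd α ρ) (continuous_cwd_moll hδ α) (hasCompactSupport_cwd_moll hδ α) x)
        (regField h hδ (U s)) = φ s := evalL2_cwd_moll_regField h hδ α (U s) x
    rw [h2] at h1
    exact h1
  -- agreement at `t = 0`
  have hu₀l : LocallyIntegrable u₀ (volume : Measure (E d)) := hu₀.continuous.locallyIntegrable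
  have h0 : Lf 0 = Rf 0 := by
    simp only [hLf, hRf, evalL2_apply, dcurve_zero, hU0, dataL2]
    rw [convolution_kernel_congr_ae (ρ := ρ) (MemLp.coeFn_toLp (memLp_cwd_data hu₀ hu₀c α)),
      convolution_kernel_congr_ae (ρ := cwd α ρ) (MemLp.coeFn_toLp (memLp_cwd_data hu₀ hu₀c [])),
      cwd_nil, ← cwd_convolution_eq_convolution_cwd (continuous_moll hδ) (hasCompactSupport_moll hδ)
        hu₀, cwd_convolution_eq_convolution_cwd_kernel (contDiff_moll hδ) (hasCompactSupport_moll hδ)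
        hu₀l]
  -- equal derivatives and equal initial values
  have hdiff : Differentiable ℝ (Lf - Rf) := fun s =>
    ((hL s).sub (hR s)).differentiableAt
  have hderiv : ∀ s, deriv (Lf - Rf) s = 0 := fun s => by
    rw [((hL s).sub (hR s)).deriv, sub_self]
  have hconst := is_const_of_deriv_eq_zero hdiff hderiv t 0
  rw [Pi.sub_apply, Pi.sub_apply, h0, sub_self, sub_eq_zero] at hconst
  -- unfold
  have hLt : Lf t = smoothRep ρ (dcurve h hδ hu₀ hu₀c U α t) x := by
    simp only [hLf, evalL2_apply, smoothRep_def]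
  have hRt : Rf t = cwd α (smoothRep ρ (U t)) x := by
    simp only [hRf, evalL2_apply]
    rw [cwd_smoothRep (contDiff_moll hδ) (hasCompactSupport_moll hδ), smoothRep_def]
  rw [← hLt, ← hRt, hconst]

/-! ### Consequences: `L²` and sup control of `∂_c(ρ_δ ⋆ U(t))` by the derived curves -/

/-- **`‖∂_c(ρ_δ ⋆ U(t))‖₂ ≤ ‖Y_c(t)‖`** (the mollifier is an `L²` contraction). [folklore] -/
theorem l2norm_cwd_smoothRep_flow_le (hU0 : U 0 = dataL2 hu₀ hu₀c)
    (hU : ∀ t, HasDerivAt U (regField h hδ (U t)) t) (c : List (Fin d)) (t : ℝ) :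
    MemLp (cwd c (smoothRep (moll (Fin d) hδ) (U t))) 2 (volume : Measure (E d)) ∧
      l2norm (cwd c (smoothRep (moll (Fin d) hδ) (U t))) ≤ ‖dcurve h hδ hu₀ hu₀c U c t‖ := by
  rw [← smoothRep_dcurve h hδ hu₀ hu₀c hU0 hU c t]
  exact l2norm_smoothRep_moll_le hδ _

/-- **`‖∂ⱼ∂_c(ρ_δ ⋆ U(t))‖₂ ≤ (C₁(j)/δ) ‖Y_c(t)‖`** (one derivative on the mollifier costs `δ⁻¹`).
[folklore] -/
theorem l2norm_cwd_cons_smoothRep_flow_le (hU0 : U 0 = dataL2 hu₀ hu₀c)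
    (hU : ∀ t, HasDerivAt U (regField h hδ (U t)) t) (j : Fin d) (c : List (Fin d)) (t : ℝ) :
    MemLp (cwd (j :: c) (smoothRep (moll (Fin d) hδ) (U t))) 2 (volume : Measure (E d)) ∧
      l2norm (cwd (j :: c) (smoothRep (moll (Fin d) hδ) (U t))) ≤
        mollDerivConst (Fin d) (bv j) / δ * ‖dcurve h hδ hu₀ hu₀c U c t‖ := by
  rw [show j :: c = [j] ++ c from rfl, cwd_append, ← smoothRep_dcurve h hδ hu₀ hu₀c hU0 hU c t]
  exact l2norm_cwd_smoothRep_moll_le hδ _ j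

/-- **Sobolev sup bound in the currency of the derived curves**:
`‖∂_c(ρ_δ ⋆ U(t))(x)‖² ≤ C_sob Σ_{|u| ≤ 2(d+1)} ‖Y_{uc}(t)‖²`. [cite: TaylorPDEIII2011, Ch. 16 §1, (1.12)] -/
theorem norm_cwd_smoothRep_flow_sq_le (hU0 : U 0 = dataL2 hu₀ hu₀c)
    (hU : ∀ t, HasDerivAt U (regField h hδ (U t)) t) (c : List (Fin d)) (t : ℝ) (x : E d) :
    ‖cwd c (smoothRep (moll (Fin d) hδ) (U t)) x‖ ^ 2 ≤ supConst (Fin d) (W k) *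
      ∑ u ∈ wordsLE (Fin d) (2 * (Fintype.card (Fin d) + 1)),
        ‖dcurve h hδ hu₀ hu₀c U (u ++ c) t‖ ^ 2 := by
  set ρ := moll (Fin d) hδ with hρ
  set f : (E d) → (W k) := cwd c (smoothRep ρ (U t)) with hf
  have hfs : ContDiff ℝ ∞ f :=
    contDiff_cwd (contDiff_smoothRep (contDiff_moll hδ) (hasCompactSupport_moll hδ) _) c
  have hb : ∀ u : List (Fin d), ∃ C : ℝ, ∀ y, ‖cwd u f y‖ ≤ C := fun u =>
    ⟨l2norm (cwd (u ++ c) ρ) * ‖U t‖, fun y => by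
      rw [hf, ← cwd_append]
      exact norm_cwd_smoothRep_le (contDiff_moll hδ) (hasCompactSupport_moll hδ) (U t) (u ++ c) y⟩
  have hm : ∀ u : List (Fin d), MemLp (cwd u f) 2 (volume : Measure (E d)) := fun u => by
    rw [hf, ← cwd_append]
    exact (memLp_cwd_smoothRep (contDiff_moll hδ) (hasCompactSupport_moll hδ) (U t) (u ++ c)).1
  have h1 := norm_sq_le_supConst_mul_wordEnergy hfs hb hm x
  refine h1.trans (mul_le_mul_of_nonneg_left ?_ (supConst_nonneg))
  refine Finset.sum_le_sum fun u _ => ?_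
  have h2 := (l2norm_cwd_smoothRep_flow_le h hδ hu₀ hu₀c hU0 hU (u ++ c) t).2
  rw [cwd_append] at h2
  exact pow_le_pow_left₀ (l2norm_nonneg _) h2 2

omit h hδ hu₀ hu₀c in
/-- The shifted sum `Σ_{|u| ≤ n} g(uc)` is dominated by the full sum `Σ_{|α| ≤ m} g(α)` when
`|c| + n ≤ m` and `g ≥ 0` (`u ↦ uc` is injective). [folklore] -/
theorem sum_append_le_sum_wordsLE {g : List (Fin d) → ℝ} (hg : ∀ α, 0 ≤ g α) {n m : ℕ}
    (c : List (Fin d)) (hc : c.length + n ≤ m) :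
    ∑ u ∈ wordsLE (Fin d) n, g (u ++ c) ≤ ∑ α ∈ wordsLE (Fin d) m, g α := by
  have hinj : Set.InjOn (fun u : List (Fin d) => u ++ c) (wordsLE (Fin d) n) :=
    fun u _ u' _ huu' => List.append_cancel_right huu'
  rw [← Finset.sum_image hinj]
  refine Finset.sum_le_sum_of_subset_of_nonneg ?_ fun α _ _ => hg α
  intro α hα
  rw [Finset.mem_image] at hα
  obtain ⟨u, hu, rfl⟩ := hα
  rw [mem_wordsLE] at hu ⊢
  simp only [List.length_append]
  omega

/-- **Sup control by the order-`m` energy**: for `|c| + 2(d+1) ≤ m`,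
`‖∂_c(ρ_δ ⋆ U(t))(x)‖² ≤ C_sob Σ_{|α| ≤ m} ‖Y_α(t)‖²`. [cite: TaylorPDEIII2011, Ch. 16 §1, (1.12)] -/
theorem norm_cwd_smoothRep_flow_sq_le_energy (hU0 : U 0 = dataL2 hu₀ hu₀c)
    (hU : ∀ t, HasDerivAt U (regField h hδ (U t)) t) {m : ℕ} (c : List (Fin d))
    (hc : c.length + 2 * (d + 1) ≤ m) (t : ℝ) (x : E d) :
    ‖cwd c (smoothRep (moll (Fin d) hδ) (U t)) x‖ ^ 2 ≤ supConst (Fin d) (W k) *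
      ∑ α ∈ wordsLE (Fin d) m, ‖dcurve h hδ hu₀ hu₀c U α t‖ ^ 2 := by
  refine (norm_cwd_smoothRep_flow_sq_le h hδ hu₀ hu₀c hU0 hU c t x).trans
    (mul_le_mul_of_nonneg_left ?_ supConst_nonneg)
  refine sum_append_le_sum_wordsLE (g := fun α => ‖dcurve h hδ hu₀ hu₀c U α t‖ ^ 2)
    (fun α => sq_nonneg _) c ?_
  simpa [Fintype.card_fin] using hc

end Curves

end Literature.Barriers.AtomisticToContinuum

end
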